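import Literature.NumberTheory.Automorphic.ShimuraCurveRibetTakahashiPairwiseEisensteinProofs
import Literature.NumberTheory.EllipticCurves.TakahashiDegreeFormulaCoprimeProofs

/-!
# k3 · gen 13 · `stub_takahashi` — companion of STUB-IDEAS-stub_takahashi-3.md (FAMILY 3)

No new obligations: (L0) the tree's discharge of the stub from the dictionary package, by name;
(T1c) the fact entails an honest eigen-line in every setup (tree corollary, cited);
(T1d) the two unit-rich rows that pin the weight/pairing convention, as kernel arithmetic.
-/

open Literature.NumberTheory.EllipticCurves Literature.NumberTheory.Automorphic
  Literature.NumberTheory.EllipticCurves.ModularForms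

namespace Summit.ABC.ABC.Cruxes.DefiniteRTControlPrime.StubIdeas3G13

/-! ### L0 — the stub from the character-group dictionary package `hDict` (tree, by name) -/
#check @takahashi2001_thm_2_3_of_coprime_of_brandtDictionary

/-! ### T1(c) — the fact forces `ξ_S ≥ 1` (rank one) in EVERY Brandt setup of type `(M, r)` -/
example (h : takahashi2001_thm_2_3_of_coprime) (W : WeierstrassCurve ℚ) [W.IsElliptic] (M r : ℕ)
    [NeZero (M * r)] (hr : r.Prime) (hcop : M.Coprime r) (hN : W.conductorNorm ℤ = M * r)
    (P : ModularParametrizationData W (M * r))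
    (hmin : ∀ (W' : WeierstrassCurve ℚ) [W'.IsElliptic], W'.conductorNorm ℤ = M * r →
      ∀ P' : ModularParametrizationData W' (M * r), P'.f = P.f → P.modularDegree ≤ P'.modularDegree)
    (S : Brandt.XiSetup M r) : 0 < S.xi (fun n => W.LFunction n) :=
  takahashi2001_thm_2_3_of_coprime.xi_pos h W M r hr hcop hN P hmin S

/-! ### T1(b) — the square law `ξ_S · c_r = δ · i²` with `i ∣ c_r` (tree corollary, cited) -/
example (h : takahashi2001_thm_2_3_of_coprime) (W : WeierstrassCurve ℚ) [W.IsElliptic] (M r : ℕ)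
    [NeZero (M * r)] (hr : r.Prime) (hcop : M.Coprime r) (hN : W.conductorNorm ℤ = M * r)
    (P : ModularParametrizationData W (M * r))
    (hmin : ∀ (W' : WeierstrassCurve ℚ) [W'.IsElliptic], W'.conductorNorm ℤ = M * r →
      ∀ P' : ModularParametrizationData W' (M * r), P'.f = P.f → P.modularDegree ≤ P'.modularDegree)
    (S : Brandt.XiSetup M r) :
    ∃ i : ℕ, 0 < i ∧ i ∣ (W.minimalDiscriminantNorm ℤ).factorization r ∧
      S.xi (fun n => W.LFunction n) * (W.minimalDiscriminantNorm ℤ).factorization r =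
        P.modularDegree * i ^ 2 :=
  takahashi2001_thm_2_3_of_coprime.xi_mul_eq_modularDegree_mul_sq h W M r hr hcop hN P hmin S

/-! ### T1(d) — the unit-rich rows, as kernel arithmetic on `(δ, ξ, c_r)`

Row `N = 14` (`r = 2`, `M = 7`, curve 14a1 = `X₀(14)`: `δ = 1`, `c₂ = ord₂(2⁶·7³) = 6`; class number 2,
Eichler mass `Σ 1/w_c = 2/3`, so `w ∈ {(3,3), (2,6)}`; `φ = e₁ − e₂`, `ξ = w₁ + w₂ ∈ {6, 8}`). -/
/-- `w = (3,3)`, `ξ = 6`: Takahashi's clauses hold with `(i, j) = (6, 1)`. -/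
example : ∃ i j : ℕ, 0 < i ∧ i * j = 6 ∧ i ∣ 6 ∧ 1 * i = 6 * j := ⟨6, 1, by norm_num⟩

/-- `w = (2,6)`, `ξ = 8` is REFUTED by the fact (no `(i, j)`): the fact pins the weights. -/
example : ¬ ∃ i j : ℕ, 0 < i ∧ i * j = 6 ∧ i ∣ 8 ∧ 1 * i = 8 * j := by
  rintro ⟨i, j, hi, hij, -, h⟩
  have hi6 : i ≤ 6 := Nat.le_of_dvd (by norm_num) ⟨j, hij.symm⟩
  have hj6 : j ≤ 6 := Nat.le_of_dvd (by norm_num) ⟨i, by rw [mul_comm]; exact hij.symm⟩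
  interval_cases i <;> interval_cases j <;> omega

/-- The transposed-pairing reading of the same row (`ξ' = ξ / content(Wφ)² = 6/9`) is not even an
integer; the nearest integer readings `ξ' ∈ {0, 1}` are refuted too. -/
example : ¬ ∃ i j : ℕ, 0 < i ∧ i * j = 6 ∧ i ∣ 1 ∧ 1 * i = 1 * j := by
  rintro ⟨i, j, hi, hij, hi1, h⟩
  have := Nat.dvd_one.mp hi1
  subst this
  omega

/-! Row `N = 15` (`r = 3`, `M = 5`, 15a1 = `X₀(15)`: `δ = 1`, `c₃ = ord₃(3⁴·5⁴) = 4`; class number 2,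
mass `Σ 1/w_c = 1` forces `w = (2,2)`, `ξ = 4`; transposed reading `ξ' = 4/2² = 1`). -/
example : ∃ i j : ℕ, 0 < i ∧ i * j = 4 ∧ i ∣ 4 ∧ 1 * i = 4 * j := ⟨4, 1, by norm_num⟩

/-- The transposed reading `ξ' = 1` passes the three weak clauses with `(i, j) = (2, 2)` but fails
`i ∣ ξ'` — the clause that encodes Takahashi's "`i_r` divides `h_r`". -/
example : (∃ i j : ℕ, 0 < i ∧ i * j = 4 ∧ 1 * i = 1 * j) ∧
    ¬ ∃ i j : ℕ, 0 < i ∧ i * j = 4 ∧ i ∣ 1 ∧ 1 * i = 1 * j := by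
  refine ⟨⟨2, 2, by norm_num⟩, ?_⟩
  rintro ⟨i, j, hi, hij, hi1, h⟩
  have := Nat.dvd_one.mp hi1
  subst this
  omega

end Summit.ABC.ABC.Cruxes.DefiniteRTControlPrime.StubIdeas3G13
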